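import Summits.Schanuel.Schanuel.Theorems.RootDecomp1KGeneric03
import Literature.NumberTheory.Transcendental.AlgebraicGeneratorsField

/-!
# RootDecomp1K — «GENERIC CELLS», part 04: CF steps (ii)–(iii) and the Kummer torsion criterion
(lens 6, gen 13; = addendum CFEndgame.lean v3, section `DescentExactness`)

* `kummer_descent_pow`, `natDegree_minpoly_zpow_mul_zpow_le` — step (iii) of the `CylinderFunnel` plan:
  from `γ^q = y^p` with `a p + b q = 1`, `δ := γ^a y^b` has `δ^q = y`, `δ^p = γ`,
  `[ℚ(δ):ℚ] ≤ [ℚ(y):ℚ]·[ℚ(γ):ℚ]`;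
* `CFExact.pow_sub_pow_lower_bound` — step (ii), the **Liouville inequality**
  `|γ^q − y^p| ≥ (2(cR)^{p+q})^{−[ℚ(y):ℚ][ℚ(γ):ℚ]}` for `γ^q ≠ y^p` (`A(y) = 0`, `B(γ) = 0`,
  `A, B ∈ ℤ[X] ∖ 0` with complex roots of modulus `≤ R`, `c = |lc A · lc B|`; the norm of the algebraic
  integer `c^{p+q}(γ^q − y^p)` of `ℚ(y, γ)` is a non-zero integer — `AlgGens.norm_ge_of_forall_norm_le`);
* `kummer_torsion d e` — (ii)+(iii)+(iv′)+(iv) in ONE statement: `∃ η > 0`, for `A, B ∈ ℤ[X] ∖ 0` of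
  degrees `≤ d, e` with roots of modulus `≤ R`, roots `y, γ ≠ 0`, `p ⊥ q`, `|lc A|^{de} < 2^q`,
  `R^{de} < (1+η)^q` and `|γ^q − y^p| < (2(|lc A · lc B| R)^{p+q})^{−de}` ⟹ `y^N = γ^N = 1`,
  `N = torsionExponent (d e)` — independent of `q`.

After parts 03 + 04 the open part of Piece CF (`CylinderFunnel`) is ONLY step (i): the roots `y_q ≈ e^u`,
`γ_q ≈ e^{ρu}` of the specialised relations along the hyper-Liouville approximants, with routine size
bookkeeping, followed by `kummer_torsion` and `cf_torsion_endgame`.  Sorry-free; standard axioms; rung 0.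
-/

noncomputable section

open Complex Polynomial

namespace Summit.Schanuel.Schanuel.Theorems.RootDecomp1KGeneric

open Summit.Schanuel.Schanuel.Theorems.RootDecomp1KHyper.HyperCell (HyperLiouville HyperLiouville.irrational
  totient_le_natDegree_of_aeval_eq_zero lt_totient_of_le)

/-! ## CF steps (ii)–(iii): Liouville exactness and the Kummer descent; the torsion criterion

* `kummer_descent_pow`, `natDegree_minpoly_zpow_mul_zpow_le` — step (iii): from `γ^q = y^p` with
  `a p + b q = 1`, `δ := γ^a y^b` has `δ^q = y`, `δ^p = γ`, `[ℚ(δ):ℚ] ≤ [ℚ(y):ℚ]·[ℚ(γ):ℚ]`;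
* `CFExact.pow_sub_pow_lower_bound` — step (ii), the **Liouville inequality**: `A(y) = 0`, `B(γ) = 0`
  (`A, B ∈ ℤ[X]∖0`, roots of modulus `≤ R`), `γ^q ≠ y^p` ⟹ `|γ^q − y^p| ≥ (2(cR)^{p+q})^{−[ℚ(y):ℚ][ℚ(γ):ℚ]}`,
  `c = |lc A · lc B|` (the norm of the algebraic integer `c^{p+q}(γ^q − y^p)` of `ℚ(y,γ)` is a non-zero
  integer; tree `AlgGens.norm_ge_of_forall_norm_le`);
* `kummer_torsion` — (ii)+(iii)+(iv′)+(iv) in one statement: under the size hypotheses, `y` and `γ` are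
  `torsionExponent(d·e)`-th roots of unity.
So the open part of Piece CF is now ONLY step (i) (roots `y_q, γ_q` of the specialised relations near
`e^u`, `e^{ρu}`, with the routine size bookkeeping) + the limit `q → ∞` into `cf_torsion_endgame`. -/

section DescentExactness

open IntermediateField NumberField
open Literature.NumberTheory.Transcendental

/-- **CF step (iii), the Kummer descent (algebra).**  If `γ^q = y^p` with `a·p + b·q = 1` and
`y, γ ≠ 0`, then `δ := γ^a · y^b` satisfies `δ^q = y` and `δ^p = γ`. -/
theorem kummer_descent_pow {y γ : ℂ} (hy : y ≠ 0) (hγ : γ ≠ 0) {p q : ℕ} {a b : ℤ}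
    (hbez : a * p + b * q = 1) (hrel : γ ^ q = y ^ p) :
    (γ ^ a * y ^ b) ^ q = y ∧ (γ ^ a * y ^ b) ^ p = γ := by
  have hrelz : γ ^ (q : ℤ) = y ^ (p : ℤ) := by exact_mod_cast hrel
  have e1 : (γ ^ a) ^ q = (γ ^ (q : ℤ)) ^ a := by
    rw [← zpow_natCast, ← zpow_mul, mul_comm, zpow_mul]
  have e2 : (y ^ b) ^ q = y ^ (b * q : ℤ) := by rw [← zpow_natCast, ← zpow_mul]
  have e3 : (y ^ b) ^ p = (y ^ (p : ℤ)) ^ b := by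
    rw [← zpow_natCast, ← zpow_mul, mul_comm, zpow_mul]
  have e4 : (γ ^ a) ^ p = γ ^ (a * p : ℤ) := by rw [← zpow_natCast, ← zpow_mul]
  constructor
  · calc (γ ^ a * y ^ b) ^ q = (γ ^ (q : ℤ)) ^ a * y ^ (b * q : ℤ) := by rw [mul_pow, e1, e2]
      _ = y ^ ((p : ℤ) * a) * y ^ (b * q : ℤ) := by rw [hrelz, ← zpow_mul]
      _ = y ^ ((p : ℤ) * a + b * q) := by rw [← zpow_add₀ hy]
      _ = y := by rw [show ((p : ℤ) * a + b * q : ℤ) = 1 by linarith, zpow_one]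
  · calc (γ ^ a * y ^ b) ^ p = γ ^ (a * p : ℤ) * (y ^ (p : ℤ)) ^ b := by rw [mul_pow, e4, e3]
      _ = γ ^ (a * p : ℤ) * γ ^ ((q : ℤ) * b) := by rw [← hrelz, ← zpow_mul]
      _ = γ ^ ((a * p : ℤ) + q * b) := by rw [← zpow_add₀ hγ]
      _ = γ := by rw [show ((a * p : ℤ) + q * b : ℤ) = 1 by linarith, zpow_one]

/-- **CF step (iii), the degree bound.**  For `y, γ` algebraic, `δ := γ^a · y^b ∈ ℚ(y, γ)`, so
`[ℚ(δ):ℚ] ≤ [ℚ(y):ℚ]·[ℚ(γ):ℚ]`. -/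
theorem natDegree_minpoly_zpow_mul_zpow_le {y γ : ℂ} (hy : IsIntegral ℚ y) (hγ : IsIntegral ℚ γ)
    (a b : ℤ) : (minpoly ℚ (γ ^ a * y ^ b)).natDegree ≤
      (minpoly ℚ y).natDegree * (minpoly ℚ γ).natDegree := by
  set E : IntermediateField ℚ ℂ := ℚ⟮y⟯ ⊔ ℚ⟮γ⟯ with hE
  haveI : FiniteDimensional ℚ ℚ⟮y⟯ := adjoin.finiteDimensional hy
  haveI : FiniteDimensional ℚ ℚ⟮γ⟯ := adjoin.finiteDimensional hγ
  have hmem : γ ^ a * y ^ b ∈ E := by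
    refine mul_mem ?_ ?_
    · exact zpow_mem ((le_sup_right : ℚ⟮γ⟯ ≤ E) (mem_adjoin_simple_self ℚ γ)) a
    · exact zpow_mem ((le_sup_left : ℚ⟮y⟯ ≤ E) (mem_adjoin_simple_self ℚ y)) b
  set d : E := ⟨γ ^ a * y ^ b, hmem⟩ with hd
  have h1 : minpoly ℚ (γ ^ a * y ^ b) = minpoly ℚ d := by
    have := minpoly.algebraMap_eq (A := ℚ) (algebraMap E ℂ).injective d
    simpa [hd] using this
  rw [h1]
  calc (minpoly ℚ d).natDegree ≤ Module.finrank ℚ E := minpoly.natDegree_le d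
    _ ≤ Module.finrank ℚ ℚ⟮y⟯ * Module.finrank ℚ ℚ⟮γ⟯ := finrank_sup_le ℚ⟮y⟯ ℚ⟮γ⟯
    _ = (minpoly ℚ y).natDegree * (minpoly ℚ γ).natDegree := by
          rw [adjoin.finrank hy, adjoin.finrank hγ]

namespace CFExact

/-- The `AlgGens` of a pair of algebraic numbers. -/
abbrev pairGens (y γ : ℂ) (hy : IsAlgebraic ℚ y) (hγ : IsAlgebraic ℚ γ) : AlgGens where
  ι := Fin 2
  a := ![y, γ]
  alg := fun i => by
    fin_cases i
    · simpa using hy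
    · simpa using hγ

variable {y γ : ℂ} (hy : IsAlgebraic ℚ y) (hγ : IsAlgebraic ℚ γ)

/-- `y` as an element of `K = ℚ(y, γ)`. -/
def genY : (pairGens y γ hy hγ).K := (pairGens y γ hy hγ).genK (0 : Fin 2)
/-- `γ` as an element of `K = ℚ(y, γ)`. -/
def genΓ : (pairGens y γ hy hγ).K := (pairGens y γ hy hγ).genK (1 : Fin 2)

/-- The coercion of `genY` to `ℂ` is `y`. -/
@[simp] theorem coe_genY : ((genY hy hγ : (pairGens y γ hy hγ).K) : ℂ) = y := rfl
/-- The coercion of `genΓ` to `ℂ` is `γ`. -/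
@[simp] theorem coe_genΓ : ((genΓ hy hγ : (pairGens y γ hy hγ).K) : ℂ) = γ := rfl

/-- `K = ℚ(y, γ)` is contained in the compositum `ℚ⟮y⟯ ⊔ ℚ⟮γ⟯`. -/
theorem pairGens_K_le : (pairGens y γ hy hγ).K ≤ ℚ⟮y⟯ ⊔ ℚ⟮γ⟯ := by
  change IntermediateField.adjoin ℚ (Set.range ![y, γ]) ≤ _
  rw [IntermediateField.adjoin_le_iff]
  rintro _ ⟨i, rfl⟩
  fin_cases i
  · exact (le_sup_left : ℚ⟮y⟯ ≤ ℚ⟮y⟯ ⊔ ℚ⟮γ⟯) (mem_adjoin_simple_self ℚ y)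
  · exact (le_sup_right : ℚ⟮γ⟯ ≤ ℚ⟮y⟯ ⊔ ℚ⟮γ⟯) (mem_adjoin_simple_self ℚ γ)

/-- `h = [ℚ(y,γ):ℚ] ≤ deg y · deg γ`. -/
theorem pairGens_h_le : (pairGens y γ hy hγ).h ≤
    (minpoly ℚ y).natDegree * (minpoly ℚ γ).natDegree := by
  haveI : FiniteDimensional ℚ ℚ⟮y⟯ := adjoin.finiteDimensional hy.isIntegral
  haveI : FiniteDimensional ℚ ℚ⟮γ⟯ := adjoin.finiteDimensional hγ.isIntegral
  rw [← AlgGens.finrank_eq_h]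
  calc Module.finrank ℚ (pairGens y γ hy hγ).K ≤ Module.finrank ℚ ↥(ℚ⟮y⟯ ⊔ ℚ⟮γ⟯) :=
        IntermediateField.finrank_le_of_le_right (pairGens_K_le hy hγ)
    _ ≤ Module.finrank ℚ ℚ⟮y⟯ * Module.finrank ℚ ℚ⟮γ⟯ := finrank_sup_le ℚ⟮y⟯ ℚ⟮γ⟯
    _ = (minpoly ℚ y).natDegree * (minpoly ℚ γ).natDegree := by
        rw [adjoin.finrank hy.isIntegral, adjoin.finrank hγ.isIntegral]

/-- A ring hom `σ : K →+* ℂ` maps a root (in `K`) of an integer polynomial to a root. -/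
theorem aeval_ringHom_eq_zero {K : Type*} [Field K] [CharZero K] (σ : K →+* ℂ) {x : K} {A : ℤ[X]}
    (hx : aeval x A = 0) : aeval (σ x) A = 0 := by
  have h1 : σ (aeval x A) = aeval (σ x) A := by
    rw [aeval_def, aeval_def, hom_eval₂]
    congr 1
    exact RingHom.ext_int _ _
  rw [← h1, hx, map_zero]

/-- **CF step (ii): the Liouville inequality for `γ^q - y^p`.**  `A(y) = 0`, `B(γ) = 0`
(`A, B ∈ ℤ[X] ∖ 0`, complex roots of modulus `≤ R`, `R ≥ 1`), `c := |lc A · lc B|`,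
`D := deg y · deg γ`.  If `γ^q ≠ y^p` then `|γ^q - y^p| ≥ (2 (c R)^{p+q})^{-D}`. -/
theorem pow_sub_pow_lower_bound {A B : ℤ[X]} (hA : A ≠ 0) (hB : B ≠ 0) {y γ : ℂ}
    (hyA : aeval y A = 0) (hγB : aeval γ B = 0) {R : ℝ} (hR : 1 ≤ R)
    (hrA : ∀ z ∈ A.aroots ℂ, ‖z‖ ≤ R) (hrB : ∀ z ∈ B.aroots ℂ, ‖z‖ ≤ R) {p q : ℕ}
    (hne : γ ^ q ≠ y ^ p) :
    ((2 * (((A.leadingCoeff * B.leadingCoeff).natAbs : ℝ) * R) ^ (p + q)) ^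
        ((minpoly ℚ y).natDegree * (minpoly ℚ γ).natDegree))⁻¹ ≤ ‖γ ^ q - y ^ p‖ := by
  classical
  -- algebraicity
  have hyI : IsIntegral ℚ y := by
    have : IsAlgebraic ℤ y := ⟨A, hA, hyA⟩
    exact (this.extendScalars (R := ℤ) (S := ℚ) (algebraMap ℤ ℚ).injective_int).isIntegral
  have hγI : IsIntegral ℚ γ := by
    have : IsAlgebraic ℤ γ := ⟨B, hB, hγB⟩
    exact (this.extendScalars (R := ℤ) (S := ℚ) (algebraMap ℤ ℚ).injective_int).isIntegral
  have hyQ : IsAlgebraic ℚ y := hyI.isAlgebraic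
  have hγQ : IsAlgebraic ℚ γ := hγI.isAlgebraic
  -- the number field K = ℚ(y, γ) and the generators in K
  have hinj : Function.Injective (algebraMap (pairGens y γ hyQ hγQ).K ℂ) :=
    (algebraMap (pairGens y γ hyQ hγQ).K ℂ).injective
  have hYc : ((genY hyQ hγQ : (pairGens y γ hyQ hγQ).K) : ℂ) = y := rfl
  have hΓc : ((genΓ hyQ hγQ : (pairGens y γ hyQ hγQ).K) : ℂ) = γ := rfl
  -- the integer c = lc A · lc B and integrality of c·Y, c·Γ
  set c : ℤ := A.leadingCoeff * B.leadingCoeff with hcdef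
  have hcA : A.leadingCoeff ≠ 0 := leadingCoeff_ne_zero.mpr hA
  have hcB : B.leadingCoeff ≠ 0 := leadingCoeff_ne_zero.mpr hB
  have hc : c ≠ 0 := mul_ne_zero hcA hcB
  have hintY : IsIntegral ℤ ((c : (pairGens y γ hyQ hγQ).K) * genY hyQ hγQ) := by
    rw [← isIntegral_algebraMap_iff hinj (R := ℤ)]
    have h1 : IsIntegral ℤ ((A.leadingCoeff : ℂ) * y) := by
      simpa [Algebra.smul_def] using isIntegral_leadingCoeff_smul (R := ℤ) (p := A) (x := y) hyA
    have h2 : IsIntegral ℤ ((B.leadingCoeff : ℂ) * ((A.leadingCoeff : ℂ) * y)) :=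
      (isIntegral_algebraMap (R := ℤ) (A := ℂ) (x := B.leadingCoeff)).mul h1
    have : algebraMap (pairGens y γ hyQ hγQ).K ℂ ((c : (pairGens y γ hyQ hγQ).K) * genY hyQ hγQ) =
        (B.leadingCoeff : ℂ) * ((A.leadingCoeff : ℂ) * y) := by
      rw [map_mul, show algebraMap (pairGens y γ hyQ hγQ).K ℂ (genY hyQ hγQ) = y from rfl]
      simp [hcdef]; ring
    rw [this]; exact h2
  have hintΓ : IsIntegral ℤ ((c : (pairGens y γ hyQ hγQ).K) * genΓ hyQ hγQ) := by
    rw [← isIntegral_algebraMap_iff hinj (R := ℤ)]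
    have h1 : IsIntegral ℤ ((B.leadingCoeff : ℂ) * γ) := by
      simpa [Algebra.smul_def] using isIntegral_leadingCoeff_smul (R := ℤ) (p := B) (x := γ) hγB
    have h2 : IsIntegral ℤ ((A.leadingCoeff : ℂ) * ((B.leadingCoeff : ℂ) * γ)) :=
      (isIntegral_algebraMap (R := ℤ) (A := ℂ) (x := A.leadingCoeff)).mul h1
    have : algebraMap (pairGens y γ hyQ hγQ).K ℂ ((c : (pairGens y γ hyQ hγQ).K) * genΓ hyQ hγQ) =
        (A.leadingCoeff : ℂ) * ((B.leadingCoeff : ℂ) * γ) := by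
      rw [map_mul, show algebraMap (pairGens y γ hyQ hγQ).K ℂ (genΓ hyQ hγQ) = γ from rfl]
      simp [hcdef]; ring
    rw [this]; exact h2
  -- the algebraic integer ξ = c^{p+q} (Γ^q − Y^p)
  set ξK : (pairGens y γ hyQ hγQ).K := (c : (pairGens y γ hyQ hγQ).K) ^ (p + q) * (genΓ hyQ hγQ ^ q - genY hyQ hγQ ^ p) with hξK
  have hξint : IsIntegral ℤ ξK := by
    have e : ξK = (c : (pairGens y γ hyQ hγQ).K) ^ p * ((c : (pairGens y γ hyQ hγQ).K) * genΓ hyQ hγQ) ^ q - (c : (pairGens y γ hyQ hγQ).K) ^ q * ((c : (pairGens y γ hyQ hγQ).K) * genY hyQ hγQ) ^ p := by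
      rw [hξK]; ring
    rw [e]
    exact (((pairGens y γ hyQ hγQ).isIntegral_intCast_K c).pow p |>.mul (hintΓ.pow q)).sub
      (((pairGens y γ hyQ hγQ).isIntegral_intCast_K c).pow q |>.mul (hintY.pow p))
  set ξ : 𝓞 (pairGens y γ hyQ hγQ).K := ⟨ξK, hξint⟩ with hξdef
  have hξC : ((ξ : (pairGens y γ hyQ hγQ).K) : ℂ) = (c : ℂ) ^ (p + q) * (γ ^ q - y ^ p) := by
    show ((ξK : (pairGens y γ hyQ hγQ).K) : ℂ) = _
    rw [hξK]; push_cast; rw [hΓc, hYc]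
  have hξ0 : ξ ≠ 0 := by
    intro h0
    have : ((ξ : (pairGens y γ hyQ hγQ).K) : ℂ) = 0 := by rw [h0]; rfl
    rw [hξC] at this
    rcases mul_eq_zero.mp this with h1 | h1
    · exact hc (by exact_mod_cast pow_eq_zero_iff'.mp h1 |>.1)
    · exact hne (sub_eq_zero.mp h1)
  -- conjugate bound
  set T : ℝ := 2 * (((c.natAbs : ℝ)) * R) ^ (p + q) with hTdef
  have hc1 : (1 : ℝ) ≤ (c.natAbs : ℝ) := by exact_mod_cast Int.natAbs_pos.mpr hc
  have hcR : (1 : ℝ) ≤ (c.natAbs : ℝ) * R := one_le_mul_of_one_le_of_one_le hc1 hR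
  have hT1 : (1 : ℝ) ≤ T := by
    have : (1 : ℝ) ≤ ((c.natAbs : ℝ) * R) ^ (p + q) := one_le_pow₀ hcR
    rw [hTdef]; linarith
  have hconj : ∀ σ : (pairGens y γ hyQ hγQ).K →+* ℂ, ‖σ (ξ : (pairGens y γ hyQ hγQ).K)‖ ≤ T := by
    intro σ
    have hYA : aeval (genY hyQ hγQ) A = 0 := by
      apply hinj
      rw [← aeval_algebraMap_apply, map_zero]
      simpa [hYc] using hyA
    have hΓB : aeval (genΓ hyQ hγQ) B = 0 := by
      apply hinj
      rw [← aeval_algebraMap_apply, map_zero]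
      simpa [hΓc] using hγB
    have hσY : ‖σ (genY hyQ hγQ)‖ ≤ R := hrA _ (mem_aroots.mpr ⟨hA, aeval_ringHom_eq_zero σ hYA⟩)
    have hσΓ : ‖σ (genΓ hyQ hγQ)‖ ≤ R := hrB _ (mem_aroots.mpr ⟨hB, aeval_ringHom_eq_zero σ hΓB⟩)
    have hσξ : σ (ξ : (pairGens y γ hyQ hγQ).K) = (c : ℂ) ^ (p + q) * ((σ (genΓ hyQ hγQ)) ^ q - (σ (genY hyQ hγQ)) ^ p) := by
      show σ ξK = _
      rw [hξK]; simp
    rw [hσξ, norm_mul, norm_pow]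
    have hcn : ‖(c : ℂ)‖ = (c.natAbs : ℝ) := by
      rw [Complex.norm_intCast, Nat.cast_natAbs, Int.cast_abs]
    rw [hcn]
    have hdiff : ‖(σ (genΓ hyQ hγQ)) ^ q - (σ (genY hyQ hγQ)) ^ p‖ ≤ 2 * R ^ (p + q) := by
      calc ‖(σ (genΓ hyQ hγQ)) ^ q - (σ (genY hyQ hγQ)) ^ p‖ ≤ ‖(σ (genΓ hyQ hγQ)) ^ q‖ + ‖(σ (genY hyQ hγQ)) ^ p‖ := norm_sub_le _ _
        _ = ‖σ (genΓ hyQ hγQ)‖ ^ q + ‖σ (genY hyQ hγQ)‖ ^ p := by rw [norm_pow, norm_pow]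
        _ ≤ R ^ q + R ^ p := add_le_add (pow_le_pow_left₀ (norm_nonneg _) hσΓ q)
            (pow_le_pow_left₀ (norm_nonneg _) hσY p)
        _ ≤ R ^ (p + q) + R ^ (p + q) := add_le_add (pow_le_pow_right₀ hR (by omega))
            (pow_le_pow_right₀ hR (by omega))
        _ = 2 * R ^ (p + q) := by ring
    calc (c.natAbs : ℝ) ^ (p + q) * ‖(σ (genΓ hyQ hγQ)) ^ q - (σ (genY hyQ hγQ)) ^ p‖
        ≤ (c.natAbs : ℝ) ^ (p + q) * (2 * R ^ (p + q)) :=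
          mul_le_mul_of_nonneg_left hdiff (by positivity)
      _ = T := by rw [hTdef, mul_pow]; ring
  -- Liouville
  have hL := (pairGens y γ hyQ hγQ).norm_ge_of_forall_norm_le hξ0 hT1 hconj
  rw [hξC, norm_mul, norm_pow] at hL
  have hcn : ‖(c : ℂ)‖ = (c.natAbs : ℝ) := by
    rw [Complex.norm_intCast, Nat.cast_natAbs, Int.cast_abs]
  rw [hcn] at hL
  -- from (T^(h-1))⁻¹ ≤ c^(p+q) * ‖γ^q - y^p‖ to the claim
  have hh1 : 1 ≤ (pairGens y γ hyQ hγQ).h := (pairGens y γ hyQ hγQ).one_le_h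
  have hhD : (pairGens y γ hyQ hγQ).h ≤ (minpoly ℚ y).natDegree * (minpoly ℚ γ).natDegree := pairGens_h_le hyQ hγQ
  set D := (minpoly ℚ y).natDegree * (minpoly ℚ γ).natDegree with hDdef
  have hcpow : (c.natAbs : ℝ) ^ (p + q) ≤ T := by
    calc (c.natAbs : ℝ) ^ (p + q) ≤ ((c.natAbs : ℝ) * R) ^ (p + q) :=
          pow_le_pow_left₀ (by positivity) (le_mul_of_one_le_right (by positivity) hR) _
      _ ≤ T := by rw [hTdef]; linarith [one_le_pow₀ (n := p + q) hcR]
  have hTpos : 0 < T := lt_of_lt_of_le one_pos hT1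
  have hcpos : (0 : ℝ) < (c.natAbs : ℝ) ^ (p + q) := by positivity
  -- ‖γ^q - y^p‖ ≥ (T^(h-1))⁻¹ / c^(p+q) ≥ (T^h)⁻¹ ≥ (T^D)⁻¹
  have h1 : (T ^ (pairGens y γ hyQ hγQ).h)⁻¹ ≤ ‖γ ^ q - y ^ p‖ := by
    have e : T ^ (pairGens y γ hyQ hγQ).h = T ^ ((pairGens y γ hyQ hγQ).h - 1) * T := by
      rw [← pow_succ]; congr 1; omega
    rw [e, mul_inv]
    calc (T ^ ((pairGens y γ hyQ hγQ).h - 1))⁻¹ * T⁻¹ ≤ (T ^ ((pairGens y γ hyQ hγQ).h - 1))⁻¹ * ((c.natAbs : ℝ) ^ (p + q))⁻¹ := by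
          apply mul_le_mul_of_nonneg_left _ (by positivity)
          exact inv_anti₀ hcpos hcpow
      _ ≤ ‖γ ^ q - y ^ p‖ := by
          rw [← div_eq_mul_inv, div_le_iff₀ hcpos, mul_comm]
          exact hL
  calc (T ^ D)⁻¹ ≤ (T ^ (pairGens y γ hyQ hγQ).h)⁻¹ := inv_anti₀ (pow_pos hTpos _) (pow_le_pow_right₀ hT1 hhD)
    _ ≤ ‖γ ^ q - y ^ p‖ := h1

end CFExact

/-- A non-zero polynomial with a root has positive degree. -/
theorem natDegree_pos_of_aeval_eq_zero' {F : ℤ[X]} (hF : F ≠ 0) {z : ℂ} (hz : aeval z F = 0) :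
    0 < F.natDegree := by
  by_contra h0
  have h0' : F.natDegree = 0 := by omega
  obtain ⟨b, hb⟩ : ∃ b, F = C b := ⟨_, eq_C_of_natDegree_eq_zero h0'⟩
  have hb0 : b ≠ 0 := by rintro rfl; exact hF (by simp [hb])
  rw [hb, aeval_C] at hz
  exact hb0 (by simpa using hz)

/-- The degree of `y` over `ℚ` is at most the degree of any integer polynomial it is a root of. -/
theorem natDegree_minpoly_le_of_aeval_eq_zero {F : ℤ[X]} (hF : F ≠ 0) {z : ℂ} (hz : aeval z F = 0) :
    (minpoly ℚ z).natDegree ≤ F.natDegree := by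
  have hFQ : F.map (Int.castRingHom ℚ) ≠ 0 := by
    simpa using (Polynomial.map_injective (Int.castRingHom ℚ) Int.cast_injective).ne hF
  have hzQ : aeval z (F.map (Int.castRingHom ℚ)) = 0 := by
    rw [show Int.castRingHom ℚ = algebraMap ℤ ℚ from rfl, aeval_map_algebraMap]; exact hz
  have hdvd : minpoly ℚ z ∣ F.map (Int.castRingHom ℚ) := minpoly.dvd ℚ z hzQ
  calc (minpoly ℚ z).natDegree ≤ (F.map (Int.castRingHom ℚ)).natDegree :=
        natDegree_le_of_dvd hdvd hFQ
    _ = F.natDegree := natDegree_map_eq_of_injective Int.cast_injective F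

/-- **CF steps (ii)+(iii)+(iv′)+(iv) combined — the KUMMER TORSION CRITERION (kernel, measure-free).**
For degree bounds `d, e` there is `η > 0` such that: if `A, B ∈ ℤ[X] ∖ 0` (`deg ≤ d, e`, complex roots of
modulus `≤ R`, `R ≥ 1`), `A(y) = 0`, `B(γ) = 0`, `y, γ ≠ 0`, `p, q` coprime, `q > 0`,
`|lc A|^{de} < 2^q`, `R^{de} < (1+η)^q`, and `|γ^q − y^p| < (2(cR)^{p+q})^{−de}` with `c = |lc A · lc B|`,
then `y` and `γ` are `N`-th roots of unity, `N = torsionExponent (d·e)` (independent of `q`). -/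
theorem kummer_torsion (d e : ℕ) : ∃ η : ℝ, 0 < η ∧
    ∀ (A B : ℤ[X]), A ≠ 0 → B ≠ 0 → A.natDegree ≤ d → B.natDegree ≤ e →
    ∀ (R : ℝ), 1 ≤ R → (∀ z ∈ A.aroots ℂ, ‖z‖ ≤ R) → (∀ z ∈ B.aroots ℂ, ‖z‖ ≤ R) →
    ∀ (y γ : ℂ), y ≠ 0 → γ ≠ 0 → aeval y A = 0 → aeval γ B = 0 →
    ∀ (p q : ℕ), 0 < q → Nat.Coprime p q →
    A.leadingCoeff.natAbs ^ (d * e) < 2 ^ q → R ^ (d * e) < (1 + η) ^ q →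
    ‖γ ^ q - y ^ p‖ <
      ((2 * (((A.leadingCoeff * B.leadingCoeff).natAbs : ℝ) * R) ^ (p + q)) ^ (d * e))⁻¹ →
    y ^ torsionExponent (d * e) = 1 ∧ γ ^ torsionExponent (d * e) = 1 := by
  classical
  obtain ⟨η, hη, hK⟩ := cf_root_of_unity (d * e)
  refine ⟨η, hη, ?_⟩
  intro A B hA hB hAd hBe R hR hrA hrB y γ hy0 hγ0 hyA hγB p q hq hcop hlcq hRq hclose
  -- degrees
  have hdy : (minpoly ℚ y).natDegree ≤ d := (natDegree_minpoly_le_of_aeval_eq_zero hA hyA).trans hAd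
  have hdγ : (minpoly ℚ γ).natDegree ≤ e := (natDegree_minpoly_le_of_aeval_eq_zero hB hγB).trans hBe
  have hd1 : 1 ≤ d := (natDegree_pos_of_aeval_eq_zero' hA hyA).trans_le hAd
  have he1 : 1 ≤ e := (natDegree_pos_of_aeval_eq_zero' hB hγB).trans_le hBe
  have hDle : (minpoly ℚ y).natDegree * (minpoly ℚ γ).natDegree ≤ d * e :=
    Nat.mul_le_mul hdy hdγ
  -- (ii) exactness
  set c : ℤ := A.leadingCoeff * B.leadingCoeff with hcdef
  have hc : c ≠ 0 := mul_ne_zero (leadingCoeff_ne_zero.mpr hA) (leadingCoeff_ne_zero.mpr hB)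
  set T : ℝ := 2 * (((c.natAbs : ℝ)) * R) ^ (p + q) with hTdef
  have hc1 : (1 : ℝ) ≤ (c.natAbs : ℝ) := by exact_mod_cast Int.natAbs_pos.mpr hc
  have hT1 : (1 : ℝ) ≤ T := by
    have : (1 : ℝ) ≤ ((c.natAbs : ℝ) * R) ^ (p + q) :=
      one_le_pow₀ (one_le_mul_of_one_le_of_one_le hc1 hR)
    rw [hTdef]; linarith
  have hexact : γ ^ q = y ^ p := by
    by_contra hne
    have hlow := CFExact.pow_sub_pow_lower_bound hA hB hyA hγB hR hrA hrB (p := p) (q := q) hne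
    have hmono : (T ^ (d * e))⁻¹ ≤
        (T ^ ((minpoly ℚ y).natDegree * (minpoly ℚ γ).natDegree))⁻¹ :=
      inv_anti₀ (pow_pos (by linarith) _) (pow_le_pow_right₀ hT1 hDle)
    have : (T ^ (d * e))⁻¹ ≤ ‖γ ^ q - y ^ p‖ := hmono.trans hlow
    rw [hTdef, hcdef] at this
    linarith
  -- (iii) descent
  obtain ⟨a, b, hbez⟩ : ∃ a b : ℤ, a * p + b * q = 1 := by
    refine ⟨Nat.gcdA p q, Nat.gcdB p q, ?_⟩
    have h := Nat.gcd_eq_gcd_ab p q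
    rw [Nat.Coprime.gcd_eq_one hcop] at h
    push_cast at h
    linarith
  obtain ⟨hδq, hδp⟩ := kummer_descent_pow hy0 hγ0 hbez hexact
  set δ := γ ^ a * y ^ b with hδdef
  have hδ0 : δ ≠ 0 := mul_ne_zero (zpow_ne_zero _ hγ0) (zpow_ne_zero _ hy0)
  have hyI : IsIntegral ℚ y := by
    have : IsAlgebraic ℤ y := ⟨A, hA, hyA⟩
    exact (this.extendScalars (R := ℤ) (S := ℚ) (algebraMap ℤ ℚ).injective_int).isIntegral
  have hγI : IsIntegral ℚ γ := by
    have : IsAlgebraic ℤ γ := ⟨B, hB, hγB⟩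
    exact (this.extendScalars (R := ℤ) (S := ℚ) (algebraMap ℤ ℚ).injective_int).isIntegral
  have hδdeg : (minpoly ℚ δ).natDegree ≤ d * e :=
    (natDegree_minpoly_zpow_mul_zpow_le hyI hγI a b).trans hDle
  have hδA : aeval (δ ^ q) A = 0 := by rw [hδq]; exact hyA
  -- (iv′) root of unity
  obtain ⟨k, hk, hδk⟩ := hK A hA R hR hrA q hq δ hδ0 hδA hδdeg hlcq hRq
  have hyk : y ^ k = 1 := by rw [← hδq, ← pow_mul, mul_comm, pow_mul, hδk, one_pow]
  have hγk : γ ^ k = 1 := by rw [← hδp, ← pow_mul, mul_comm, pow_mul, hδk, one_pow]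
  -- (iv) bounded order
  exact ⟨pow_torsionExponent_eq_one hk hyk hA (hAd.trans (Nat.le_mul_of_pos_right d he1)) hyA,
    pow_torsionExponent_eq_one hk hγk hB (hBe.trans (Nat.le_mul_of_pos_left e hd1)) hγB⟩

end DescentExactness

end Summit.Schanuel.Schanuel.Theorems.RootDecomp1KGeneric
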